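import Mathlib
import Summits.Ventures.PercRepro2.Defs
import Summits.Ventures.PercRepro2.Independence
import Summits.Ventures.PercRepro2.Harris
import Summits.Ventures.PercRepro2.Graph
import Summits.Ventures.PercRepro2.Events
import Summits.Ventures.PercRepro2.ZCClusterBlind
import Summits.Ventures.PercRepro2.ZCRootDecomp
import Summits.Ventures.PercRepro2.ZCCondProb
import Summits.Ventures.PercRepro2.ZCThetaPA

/-!
# `(Θ-PA)` is false: an exact five-edge witness (blind cell PercRepro2, mine-a g29)

`ThetaPA ends p a₁ a₃ o` (ZCThetaPA.lean) asks the (ZC) expression `P(D)·Cov(f, eL) − P(B)·Cov(f, e¬L)` to be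
nonnegative for EVERY monotone function `f` of the connectivity relation of `G − a₁`.  It is false.

The witness: the 4-cycle `0 – 1 – 3 – 2 – 0` with the root `a₁ = 4` pendant at `1`; marks `a₃ = 2`, `o = 0`;
weights `p(0,1) = 1/4`, `p(0,2) = 3/4`, `p(1,3) = 3/4`, `p(2,3) = 3/4`, `p(4,1) = 1/2`;
`f = 1[vertex 3 is connected to 1 or to 2 in G − a₁]` (vertex `3` is not isolated).  Then
`P(D) = 19/128`, `P(B) = 33/64`, `E[f] = 15/16`, `P(eL) = 69/256`, `P(e¬L) = 27/512`, `E[f·1_{eL}] = 135/512`,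
`E[f·1_{e¬L}] = 27/512`, and the (ZC) expression equals `−9/131072 < 0` (MINE-A.md §81: on `e¬L` the route
`a₁ – 1 – 3 – 2` is forced, so `f ≡ 1` there — the routes mechanism in its purest form).  Consequently the
hypothesis of `zc_of_thetaPA` is not a theorem; row 2′ZC (cluster up-sets of `C(a₁)`) itself holds on this graph
for all 166 cluster up-sets (exact enumeration, data/mine-a/g29/).
-/

namespace Summit.Ventures.PercRepro2

namespace ThetaPAFalse

/-- The witness graph: the 4-cycle `0–1–3–2–0` and the root edge `4–1`. -/
def wEnds : Fin 5 → Sym2 (Fin 5) := ![s(0, 1), s(0, 2), s(1, 3), s(2, 3), s(4, 1)]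

/-- The witness weights. -/
def wP : Fin 5 → ℚ := ![1 / 4, 3 / 4, 3 / 4, 3 / 4, 1 / 2]

/-- `G − a₁` of a configuration: the root edge closed, the cycle untouched. -/
lemma deleteVertex_wEnds (ω : Config (Fin 5)) :
    deleteVertex wEnds 4 ω = ![ω 0, ω 1, ω 2, ω 3, false] := by
  ext e
  fin_cases e <;> simp [deleteVertex, restrict, touches, wEnds]

/-- The test function: vertex `3` is connected to `1` or to `2` in `G − a₁`. -/
def wF (ω : Config (Fin 5)) : ℚ :=
  if Conn wEnds (deleteVertex wEnds 4 ω) 3 1 ∨ Conn wEnds (deleteVertex wEnds 4 ω) 3 2 then 1 else 0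

/-- `wF` is monotone. -/
lemma wF_mono : Monotone wF := by
  intro ω ω' h
  unfold wF
  have hd := deleteVertex_mono wEnds 4 h
  split_ifs with h1 h2
  · exact le_rfl
  · exact absurd (h1.imp (conn_mono hd) (conn_mono hd)) h2
  · norm_num
  · exact le_rfl

/-- `wF` depends only on the connectivity relation of `G − a₁`. -/
lemma wF_congr (ω ω' : Config (Fin 5))
    (h : ∀ u v, Conn wEnds (deleteVertex wEnds 4 ω) u v ↔ Conn wEnds (deleteVertex wEnds 4 ω') u v) :
    wF ω = wF ω' := by
  unfold wF
  exact if_congr (or_congr (h 3 1) (h 3 2)) rfl rfl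

/-- `e = {a₁ ↔ a₃}` on the witness, as a Boolean formula of the five edges. -/
lemma conn_4_2 (ω : Fin 5 → Bool) :
    Conn wEnds ω 4 2 ↔ (ω 4 = true ∧ ((ω 0 = true ∧ ω 1 = true) ∨ (ω 2 = true ∧ ω 3 = true))) := by
  revert ω; decide

/-- `L = {a₁ ↔ o}` on the witness. -/
lemma conn_4_0 (ω : Fin 5 → Bool) :
    Conn wEnds ω 4 0 ↔ (ω 4 = true ∧ (ω 0 = true ∨ (ω 1 = true ∧ ω 2 = true ∧ ω 3 = true))) := by
  revert ω; decide

/-- `γ = {a₃ ↔ o}` on the witness. -/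
lemma conn_2_0 (ω : Fin 5 → Bool) :
    Conn wEnds ω 2 0 ↔ (ω 1 = true ∨ (ω 0 = true ∧ ω 2 = true ∧ ω 3 = true)) := by
  revert ω; decide

/-- `wF` as a Boolean formula: vertex `3` is not isolated in the cycle. -/
lemma wF_eq (ω : Fin 5 → Bool) : wF ω = if (ω 2 = true ∨ ω 3 = true) then 1 else 0 := by
  have key : ∀ ω : Fin 5 → Bool,
      (Conn wEnds (![ω 0, ω 1, ω 2, ω 3, false]) 3 1 ∨ Conn wEnds (![ω 0, ω 1, ω 2, ω 3, false]) 3 2) ↔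
        (ω 2 = true ∨ ω 3 = true) := by
    decide
  unfold wF
  rw [deleteVertex_wEnds, if_congr (key ω) rfl rfl]

/-- A sum over the configurations of five edges as five nested sums over booleans. -/
lemma sum_config_five {M : Type*} [AddCommMonoid M] (f : (Fin 5 → Bool) → M) :
    ∑ ω, f ω = ∑ b0, ∑ b1, ∑ b2, ∑ b3, ∑ b4, f ![b0, b1, b2, b3, b4] := by
  rw [← Equiv.sum_comp (⟨fun b => ![b.1, b.2.1, b.2.2.1, b.2.2.2.1, b.2.2.2.2],
    fun ω => (ω 0, ω 1, ω 2, ω 3, ω 4), fun _ => rfl, fun ω => by ext i; fin_cases i <;> rfl⟩ :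
    Bool × Bool × Bool × Bool × Bool ≃ (Fin 5 → Bool))]
  simp only [Fintype.sum_prod_type]
  rfl

/-- The (ZC) expression of `wF` on the witness is `−9/131072`. -/
lemma zc_value :
    prob wP ((connEvent wEnds 4 2)ᶜ ∩ (connEvent wEnds 4 0)ᶜ ∩ (connEvent wEnds 2 0)ᶜ) *
        (expect wP (fun ω => wF ω * (connEvent wEnds 4 2 ∩ connEvent wEnds 4 0).indicator 1 ω) -
          expect wP wF * prob wP (connEvent wEnds 4 2 ∩ connEvent wEnds 4 0)) -
      prob wP ((connEvent wEnds 4 2)ᶜ ∩ (connEvent wEnds 4 0)ᶜ ∩ connEvent wEnds 2 0) *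
        (expect wP (fun ω => wF ω * (connEvent wEnds 4 2 ∩ (connEvent wEnds 4 0)ᶜ).indicator 1 ω) -
          expect wP wF * prob wP (connEvent wEnds 4 2 ∩ (connEvent wEnds 4 0)ᶜ)) = -9 / 131072 := by
  classical
  simp only [prob, expect, sum_config_five, Set.indicator_apply, Set.mem_inter_iff, Set.mem_compl_iff,
    mem_connEvent, conn_4_2, conn_4_0, conn_2_0, wF_eq, Fintype.sum_bool, Matrix.cons_val_zero,
    Matrix.cons_val_one, Matrix.cons_val, weight_apply, Fin.prod_univ_five, edgeFactor_true, edgeFactor_false,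
    wP]
  norm_num

/-- **`(Θ-PA)` is false**: the witness graph violates `ThetaPA`. -/
theorem thetaPA_false : ¬ ThetaPA wEnds wP 4 2 0 := by
  intro h
  have key := h wF wF_mono wF_congr
  simp only [] at key
  rw [zc_value] at key
  norm_num at key

end ThetaPAFalse

end Summit.Ventures.PercRepro2
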